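import Summits.RiemannHypothesis.RiemannHypothesis.Theorems.PfPersistenceFfWeilCriterion
import Literature.NumberTheory.EllipticCurves.ComplexMultiplicationSingularModuli

/-!
# Function-field mirror: SHARPNESS of the finite-depth Weil criterion
(pub-rhpf, seat ffmirror-2 gen 5; HONEST FRAMING: mechanism/rigidity campaign — no RH claims)

`PfPersistenceFfWeilCriterion.weilWindowForm_posSemidef_iff`: for `q > 0` and a reciprocal `h ∈ ℤ[x]` with
`h(0) ≠ 0`, ONE window form `T_M(q, h)` with `deg h ≤ M + 1` is positive semidefinite iff the function-field
RH holds for `(q, h)`.  This file kernel-checks that the depth `deg h` cannot be lowered ([folklore],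
explicit computation): for `q = 4` and
`h♯ = x⁴ - 5x³ + 8x² - 20x + 16 = (x - 1)(x - 4)(x² + 4)` (roots `1, 4, ±2i`, closed under `α ↦ 4/α`,
`h♯(0) = 16 ≠ 0`, RH FALSE since `|4| = 4 ≠ 2 = √4`) the window `M = 2` of size `3 = deg h♯ - 1` is
`T_2 = [[2, 5/4, 9/8], [5/4, 2, 5/4], [9/8, 5/4, 2]]`, positive semidefinite by the explicit sum of hermitian
squares `x* T_2 x = 2|x₀ + ⅝x₁ + 9⁄16 x₂|² + 39⁄32 |x₁ + 35⁄78 x₂|² + 175⁄156 |x₂|²`, while `T_3` (size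
`deg h♯`) is not (by the criterion): `sharp_witness`.  In the cell's vocabulary: an honest RH-VIOLATING
function-field datum whose window tower is positive up to and including the window `2g - 2` — positivity
failure of an off-circle datum need not be visible before the last informative window `2g - 1`.
Nothing here is a statement about ζ; no RH claim in either direction.
-/

set_option linter.dupNamespace false  -- the mandated namespace repeats `RiemannHypothesis`

noncomputable section

open Polynomial Matrix Finset
open scoped ComplexOrder ComplexConjugate

namespace Summit.RiemannHypothesis.RiemannHypothesis.Theorems.PfPersistence.FfAngleTwin

/-! ## Sharpness of the depth: `q = 4`, `h♯ = x⁴ - 5x³ + 8x² - 20x + 16` -/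

/-- `√4 = 2` cast to `ℂ` (the real statement is `Literature.NumberTheory.EllipticCurves.sqrt_four`,
imported and reused below, not restated). [folklore] -/
theorem sqrt_four : (Real.sqrt 4 : ℂ) = 2 := by
  rw [Literature.NumberTheory.EllipticCurves.sqrt_four]; norm_num

/-- The sharpness polynomial `h♯ = x⁴ - 5x³ + 8x² - 20x + 16 = (x - 1)(x - 4)(x² + 4)`. [folklore] -/
def hSharp : ℤ[X] := X ^ 4 - 5 * X ^ 3 + 8 * X ^ 2 - 20 * X + 16

/-- Its complex roots `1, 4, 2i, -2i`. [folklore] -/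
def rootsSharp : Multiset ℂ := {1, 4, 2 * Complex.I, -(2 * Complex.I)}

/-- `h♯ = (x - 1)(x - 4)(x - 2i)(x + 2i)` over `ℂ`. [folklore] -/
theorem map_hSharp : hSharp.map (Int.castRingHom ℂ) = (rootsSharp.map fun w => X - C w).prod := by
  have hC : C (2 * Complex.I) * C (2 * Complex.I) = (-4 : ℂ[X]) := by
    rw [← map_mul, show (2 * Complex.I) * (2 * Complex.I) = (-4 : ℂ) by
      linear_combination (4:ℂ) * Complex.I_sq, map_neg, map_ofNat]
  simp only [hSharp, rootsSharp, Multiset.insert_eq_cons, Multiset.map_cons, Multiset.map_singleton,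
    Multiset.prod_cons, Multiset.prod_singleton, Polynomial.map_add, Polynomial.map_sub,
    Polynomial.map_mul, Polynomial.map_pow, Polynomial.map_X, Polynomial.map_ofNat, map_one, map_neg,
    map_ofNat, sub_neg_eq_add]
  linear_combination (X - 1) * (X - 4) * hC

/-- `frobRoots h♯ = {1, 4, 2i, -2i}`. [folklore] -/
theorem frobRoots_hSharp : frobRoots hSharp = rootsSharp := by
  unfold frobRoots
  rw [map_hSharp, roots_multiset_prod_X_sub_C]

/-- `deg h♯ = 4`. [folklore] -/
theorem natDegree_hSharp : hSharp.natDegree = 4 := by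
  rw [← card_frobRoots_eq_natDegree, frobRoots_hSharp]
  simp [rootsSharp]

/-- The roots of `h♯` are closed under `α ↦ 4/α` (functional equation with `q = 4`). [folklore] -/
theorem rootsSharp_reciprocal : rootsSharp.map (fun α => (4:ℂ) / α) = rootsSharp := by
  have hI : (4:ℂ) / (2 * Complex.I) = -(2 * Complex.I) := by
    rw [div_eq_iff (mul_ne_zero two_ne_zero Complex.I_ne_zero)]
    linear_combination (4:ℂ) * Complex.I_sq
  have hI' : (4:ℂ) / -(2 * Complex.I) = 2 * Complex.I := by rw [div_neg, hI, neg_neg]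
  simp only [rootsSharp, Multiset.insert_eq_cons, Multiset.map_cons, Multiset.map_singleton]
  rw [div_one, div_self (four_ne_zero : (4:ℂ) ≠ 0), hI, hI']
  calc (4:ℂ) ::ₘ 1 ::ₘ -(2 * Complex.I) ::ₘ {2 * Complex.I}
      = 1 ::ₘ 4 ::ₘ -(2 * Complex.I) ::ₘ {2 * Complex.I} := Multiset.cons_swap _ _ _
    _ = 1 ::ₘ 4 ::ₘ (2 * Complex.I) ::ₘ {-(2 * Complex.I)} := by
        congr 2; exact Multiset.cons_swap _ _ 0

/-- `0` is not a root of `h♯` (`h♯(0) = 16`). [folklore] -/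
theorem zero_not_mem_rootsSharp : (0:ℂ) ∉ rootsSharp := by
  simp [rootsSharp, Complex.ext_iff]

/-- The normalised roots `{1/2, 2, i, -i}` of the sharpness datum. [folklore] -/
theorem normRoots_sharp : normRoots 4 rootsSharp = {1 / 2, 2, Complex.I, -Complex.I} := by
  simp only [normRoots, rootsSharp, Multiset.insert_eq_cons, Multiset.map_cons,
    Multiset.map_singleton, sqrt_four]
  rw [show (4:ℂ) / 2 = 2 by norm_num, show 2 * Complex.I / 2 = Complex.I by ring,
    show -(2 * Complex.I) / 2 = -Complex.I by ring]

/-- The Toeplitz symbol of the sharpness datum. [folklore] -/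
theorem ffKernel_sharp (n : ℕ) : ffKernel 4 rootsSharp n =
    ((1 / 2 : ℂ) ^ n + 2 ^ n + Complex.I ^ n + (-Complex.I) ^ n) / 2 := by
  rw [ffKernel, normRoots_sharp]
  simp only [powerSum, Multiset.insert_eq_cons, Multiset.map_cons, Multiset.map_singleton,
    Multiset.sum_cons, Multiset.sum_singleton]
  ring

/-- `K(0) = 2`. [folklore] -/
theorem ffKernel_sharp_zero : ffKernel 4 rootsSharp 0 = 2 := by
  rw [ffKernel_sharp]; norm_num

/-- `K(1) = 5/4`. [folklore] -/
theorem ffKernel_sharp_one : ffKernel 4 rootsSharp 1 = 5 / 4 := by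
  rw [ffKernel_sharp]; ring

/-- `K(2) = 9/8`. [folklore] -/
theorem ffKernel_sharp_two : ffKernel 4 rootsSharp 2 = 9 / 8 := by
  rw [ffKernel_sharp]; linear_combination Complex.I_sq

/-- The window `M = 2` of the sharpness datum: `T_2 = [[2, 5/4, 9/8], [5/4, 2, 5/4], [9/8, 5/4, 2]]`.
[folklore] -/
theorem windowForm_sharp_two :
    ffWindowForm 4 rootsSharp 2 = !![2, 5 / 4, 9 / 8; 5 / 4, 2, 5 / 4; 9 / 8, 5 / 4, 2] := by
  ext m m'
  fin_cases m <;> fin_cases m' <;>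
    simp [ffWindowForm, Nat.dist, ffKernel_sharp_zero, ffKernel_sharp_one, ffKernel_sharp_two]

/-- `T_2` of the sharpness datum is positive semidefinite: `x* T_2 x` is the explicit sum of hermitian
squares `2|x₀ + ⅝x₁ + 9⁄16 x₂|² + 39⁄32 |x₁ + 35⁄78 x₂|² + 175⁄156 |x₂|²`. [folklore] -/
theorem windowForm_sharp_two_posSemidef : (ffWindowForm 4 rootsSharp 2).PosSemidef := by
  rw [windowForm_sharp_two]
  refine Matrix.PosSemidef.of_dotProduct_mulVec_nonneg ?_ fun x => ?_
  · refine Matrix.IsHermitian.ext fun i j => ?_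
    fin_cases i <;> fin_cases j <;> simp
  · have key : star x ⬝ᵥ (!![2, 5 / 4, 9 / 8; 5 / 4, 2, 5 / 4; 9 / 8, 5 / 4, (2:ℂ)] *ᵥ x) =
        2 * (conj (x 0 + 5 / 8 * x 1 + 9 / 16 * x 2) * (x 0 + 5 / 8 * x 1 + 9 / 16 * x 2)) +
        39 / 32 * (conj (x 1 + 35 / 78 * x 2) * (x 1 + 35 / 78 * x 2)) +
        175 / 156 * (conj (x 2) * x 2) := by
      simp only [map_add, map_mul, map_div₀, map_ofNat]
      simp [dotProduct, Matrix.mulVec, Fin.sum_univ_three]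
      ring
    rw [key]
    have h1 := star_mul_self_nonneg (x 0 + 5 / 8 * x 1 + 9 / 16 * x 2)
    have h2 := star_mul_self_nonneg (x 1 + 35 / 78 * x 2)
    have h3 := star_mul_self_nonneg (x 2)
    rw [Complex.star_def] at h1 h2 h3
    have c1 : (0:ℂ) ≤ 2 := by exact_mod_cast Complex.zero_le_real.2 (by norm_num : (0:ℝ) ≤ 2)
    have e2 : ((39 / 32 : ℝ) : ℂ) = 39 / 32 := by push_cast; ring
    have e3 : ((175 / 156 : ℝ) : ℂ) = 175 / 156 := by push_cast; ring
    have c2 : (0:ℂ) ≤ 39 / 32 := by rw [← e2]; exact Complex.zero_le_real.2 (by norm_num)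
    have c3 : (0:ℂ) ≤ 175 / 156 := by rw [← e3]; exact Complex.zero_le_real.2 (by norm_num)
    exact add_nonneg (add_nonneg (mul_nonneg c1 h1) (mul_nonneg c2 h2)) (mul_nonneg c3 h3)

/-- SHARPNESS WITNESS: the datum `(4, h♯)` satisfies every hypothesis of the criterion
(reciprocal, `h♯(0) ≠ 0`, `deg h♯ = 4`), violates the function-field RH (`|4| = 4 ≠ 2 = √4`), its window
`M = 2` (size `3 = deg h♯ - 1`) IS positive semidefinite, and its window `M = 3` (size `deg h♯`) is not:
the depth `deg h` in `weilWindowForm_posSemidef_iff` cannot be lowered. [folklore] -/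
theorem sharp_witness :
    (frobRoots hSharp).map (fun α => ((4:ℝ):ℂ) / α) = frobRoots hSharp ∧
    (0:ℂ) ∉ frobRoots hSharp ∧ hSharp.natDegree = 4 ∧
    ¬ (∀ α ∈ frobRoots hSharp, ‖α‖ = Real.sqrt 4) ∧
    (weilWindowForm 4 hSharp 2).PosSemidef ∧ ¬ (weilWindowForm 4 hSharp 3).PosSemidef := by
  have hrec : (frobRoots hSharp).map (fun α => ((4:ℝ):ℂ) / α) = frobRoots hSharp := by
    rw [frobRoots_hSharp, show (fun α : ℂ => ((4:ℝ):ℂ) / α) = fun α => (4:ℂ) / α from by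
      funext α; push_cast; rfl]
    exact rootsSharp_reciprocal
  have h0 : (0:ℂ) ∉ frobRoots hSharp := by rw [frobRoots_hSharp]; exact zero_not_mem_rootsSharp
  have hnot : ¬ (∀ α ∈ frobRoots hSharp, ‖α‖ = Real.sqrt 4) := by
    intro hRH
    have h4 : (4:ℂ) ∈ frobRoots hSharp := by rw [frobRoots_hSharp]; simp [rootsSharp]
    have := hRH 4 h4
    rw [Literature.NumberTheory.EllipticCurves.sqrt_four] at this
    norm_num at this
  refine ⟨hrec, h0, natDegree_hSharp, hnot, ?_, ?_⟩
  · rw [weilWindowForm, frobRoots_hSharp]; exact windowForm_sharp_two_posSemidef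
  · exact weilWindowForm_not_posSemidef_of_offCircle (by norm_num) hrec h0
      (by push Not at hnot; exact hnot) (by rw [natDegree_hSharp])

end Summit.RiemannHypothesis.RiemannHypothesis.Theorems.PfPersistence.FfAngleTwin

end
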